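import Literature.Geometry.GeometricMeasureTheory.AreaFormula
import Mathlib.LinearAlgebra.Matrix.AbsoluteValue
import Mathlib.MeasureTheory.Integral.Lebesgue.DominatedConvergence
import HarnessLib

/-!
# Hausdorff integrals over images of converging injective `C¹` immersions converge

Topic `Literature/Geometry/GeometricMeasureTheory` (continuation of `AreaFormula.lean`).  Let
`Fₖ, F : P → V` (`dim P = n`, `V` a real inner product space) be injective immersions of class
`C¹` on an open set `U`, with `Fₖ → F` and `DFₖ → DF` pointwise on a measurable `S ⊆ U` of finite
Lebesgue measure and `‖DFₖ‖ ≤ B` on `S` (eventually).  Then for every bounded continuous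
`g : V → [0, ∞]`,

  `∫_{Fₖ(S)} g d𝓗ⁿ → ∫_{F(S)} g d𝓗ⁿ`  (`tendsto_lintegral_image_of_tendsto`),

with `𝓗ⁿ = μHE[n]`: by the area formula both sides are `∫_S g(F x) J F(x) dx` with the Jacobian
`J F = √det(⟪DF bᵢ, DF bⱼ⟫)`, which converges pointwise and is dominated on `S`
(`sqrt_det_gram_le` : `J A ≤ √(n! ‖A‖^{2n})`), so dominated convergence applies.  This is the
measure-theoretic input for passing Gaussian density ratios to the limit along locally
`C¹`-converging sequences of submanifolds (White 2005, proof of Thm. 3.1: the Gaussian density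
bound `Θ ≤ 1 + ε` survives in the blow-up limit).

Everything is PROVED; no definitions, no named facts.

## References

* H. Federer, *Geometric Measure Theory*, Springer 1969, 3.2.3, 3.2.5. [Federer1969]
* B. White, *A local regularity theorem for mean curvature flow*, Ann. of Math. 161 (2005),
  proof of Thm. 3.1, p. 1498 (6). [White2005]
-/

open scoped ENNReal NNReal Topology RealInnerProductSpace
open Set Filter Function MeasureTheory MeasureTheory.Measure Module

noncomputable section

namespace Literature.Geometry.GeometricMeasureTheory

section Bounds

variable {P V : Type*} [NormedAddCommGroup P] [InnerProductSpace ℝ P]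
  [NormedAddCommGroup V] [InnerProductSpace ℝ V]
  {ι : Type*} [Fintype ι] [DecidableEq ι]

omit [DecidableEq ι] in
/-- Entries of the Gram matrix of `A bᵢ` are bounded by `‖A‖²` (`b` orthonormal). [folklore] -/
theorem abs_inner_apply_le_norm_sq (b : OrthonormalBasis ι ℝ P) (A : P →L[ℝ] V) (i j : ι) :
    |⟪A (b i), A (b j)⟫| ≤ ‖A‖ ^ 2 := by
  refine (abs_real_inner_le_norm _ _).trans ?_
  have hi : ‖A (b i)‖ ≤ ‖A‖ := by simpa [b.orthonormal.1 i] using A.le_opNorm (b i)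
  have hj : ‖A (b j)‖ ≤ ‖A‖ := by simpa [b.orthonormal.1 j] using A.le_opNorm (b j)
  rw [sq]
  exact mul_le_mul hi hj (norm_nonneg _) (norm_nonneg _)

/-- **A crude bound for the Jacobian**: `√det(⟪A bᵢ, A bⱼ⟫) ≤ √(n! (‖A‖²)ⁿ)` (Hadamard would give
`‖A‖ⁿ`; any bound polynomial in `‖A‖` suffices for dominated convergence). [folklore] -/
theorem sqrt_det_gram_le (b : OrthonormalBasis ι ℝ P) (A : P →L[ℝ] V) :
    Real.sqrt (Matrix.of fun i j => ⟪A (b i), A (b j)⟫).det ≤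
      Real.sqrt ((Fintype.card ι).factorial * (‖A‖ ^ 2) ^ Fintype.card ι) := by
  refine Real.sqrt_le_sqrt ((le_abs_self _).trans ?_)
  have h := Matrix.det_le (A := Matrix.of fun i j => ⟪A (b i), A (b j)⟫)
    (abv := AbsoluteValue.abs) (x := ‖A‖ ^ 2) fun i j => abs_inner_apply_le_norm_sq b A i j
  simpa [nsmul_eq_mul] using h

/-- The Jacobian `A ↦ √det(⟪A bᵢ, A bⱼ⟫)` is continuous in the linear map. [folklore] -/
theorem continuous_sqrt_det_gram (b : OrthonormalBasis ι ℝ P) :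
    Continuous fun A : P →L[ℝ] V => Real.sqrt (Matrix.of fun i j => ⟪A (b i), A (b j)⟫).det := by
  have hG : Continuous fun A : P →L[ℝ] V =>
      (Matrix.of fun i j => ⟪A (b i), A (b j)⟫ : Matrix ι ι ℝ) :=
    continuous_pi fun i => continuous_pi fun j =>
      ((ContinuousLinearMap.apply ℝ V (b i)).continuous).inner
        ((ContinuousLinearMap.apply ℝ V (b j)).continuous)
  exact Real.continuous_sqrt.comp (hG.matrix_det)

end Bounds

section Limits

variable {P V : Type*} [NormedAddCommGroup P] [InnerProductSpace ℝ P] [FiniteDimensional ℝ P]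
  [MeasurableSpace P] [BorelSpace P]
  [NormedAddCommGroup V] [InnerProductSpace ℝ V] [MeasurableSpace V] [BorelSpace V]

/-- **Hausdorff integrals over images of converging injective `C¹` immersions converge.**  Let
`U ⊆ P` be open, `S ⊆ U` measurable with `vol S < ∞`; let `Fₖ` (`k` along a countably generated
filter `l`) and `F` be differentiable on `U` with continuous derivatives, injective on `U` with
injective differentials; assume `Fₖ x → F x` and `DFₖ x → DF x` for `x ∈ S`, and eventually
`‖DFₖ x‖ ≤ B` on `S`.  Then for every continuous `g : V → [0, ∞]` bounded by `G < ∞`,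
`∫_{Fₖ(S)} g dμHE[n] → ∫_{F(S)} g dμHE[n]` (`n = dim P`). [cite: Federer1969, 3.2.5] -/
theorem tendsto_lintegral_image_of_tendsto {κ : Type*} {l : Filter κ} [l.IsCountablyGenerated]
    {U : Set P} (hU : IsOpen U)
    {Fs : κ → P → V} {Fs' : κ → P → P →L[ℝ] V} {F : P → V} {F' : P → P →L[ℝ] V}
    (hFs : ∀ k, ∀ x ∈ U, HasFDerivAt (Fs k) (Fs' k x) x) (hFs'c : ∀ k, ContinuousOn (Fs' k) U)
    (hinjs : ∀ k, InjOn (Fs k) U) (himms : ∀ k, ∀ x ∈ U, Injective (Fs' k x))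
    (hF : ∀ x ∈ U, HasFDerivAt F (F' x) x) (hF'c : ContinuousOn F' U)
    (hinj : InjOn F U) (himm : ∀ x ∈ U, Injective (F' x))
    {S : Set P} (hS : MeasurableSet S) (hSU : S ⊆ U) (hSfin : volume S ≠ ∞)
    (hconv : ∀ x ∈ S, Tendsto (fun k => Fs k x) l (𝓝 (F x)))
    (hconv' : ∀ x ∈ S, Tendsto (fun k => Fs' k x) l (𝓝 (F' x)))
    {B : ℝ} (hB : ∀ᶠ k in l, ∀ x ∈ S, ‖Fs' k x‖ ≤ B)
    {g : V → ℝ≥0∞} (hg : Continuous g) {G : ℝ≥0∞} (hG : G ≠ ∞) (hgG : ∀ y, g y ≤ G) :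
    Tendsto (fun k => ∫⁻ y in Fs k '' S, g y ∂(μHE[finrank ℝ P] : Measure V)) l
      (𝓝 (∫⁻ y in F '' S, g y ∂(μHE[finrank ℝ P] : Measure V))) := by
  set b := stdOrthonormalBasis ℝ P with hb
  set J : (P →L[ℝ] V) → ℝ≥0∞ := fun A =>
    ENNReal.ofReal (Real.sqrt (Matrix.of fun i j => ⟪A (b i), A (b j)⟫).det) with hJ
  have hJc : Continuous J := ENNReal.continuous_ofReal.comp (continuous_sqrt_det_gram b)
  -- area formula on both sides
  have hAF : ∀ k, ∫⁻ y in Fs k '' S, g y ∂(μHE[finrank ℝ P] : Measure V) =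
      ∫⁻ x in S, g (Fs k x) * J (Fs' k x) := fun k =>
    lintegral_image_eq_lintegral_mul_sqrt_det_gram b hU (hFs k) (hFs'c k) (hinjs k) (himms k) hS
      hSU hg.measurable
  have hAF0 : ∫⁻ y in F '' S, g y ∂(μHE[finrank ℝ P] : Measure V) =
      ∫⁻ x in S, g (F x) * J (F' x) :=
    lintegral_image_eq_lintegral_mul_sqrt_det_gram b hU hF hF'c hinj himm hS hSU hg.measurable
  simp only [hAF, hAF0]
  -- dominated convergence on `S`
  set n := Fintype.card (Fin (finrank ℝ P)) with hn
  set C : ℝ≥0∞ := G * ENNReal.ofReal (Real.sqrt (n.factorial * (B ^ 2) ^ n)) with hC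
  refine tendsto_lintegral_filter_of_dominated_convergence' (fun _ => C) ?_ ?_ ?_ ?_
  · -- a.e.-measurability of the integrands on `S`
    refine Eventually.of_forall fun k => ?_
    have hFc : ContinuousOn (Fs k) U := fun x hx => (hFs k x hx).continuousAt.continuousWithinAt
    have h1 : AEMeasurable (fun x => g (Fs k x)) (volume.restrict S) :=
      hg.measurable.comp_aemeasurable ((hFc.mono hSU).aemeasurable hS)
    have h2 : AEMeasurable (fun x => J (Fs' k x)) (volume.restrict S) :=
      hJc.measurable.comp_aemeasurable (((hFs'c k).mono hSU).aemeasurable hS)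
    exact h1.mul h2
  · -- domination by the constant `C`
    filter_upwards [hB] with k hk
    refine (ae_restrict_iff' hS).2 (Eventually.of_forall fun x hx => ?_)
    refine mul_le_mul' (hgG _) (ENNReal.ofReal_le_ofReal ?_)
    refine (sqrt_det_gram_le b (Fs' k x)).trans (Real.sqrt_le_sqrt ?_)
    have h0 : 0 ≤ ‖Fs' k x‖ := norm_nonneg _
    have hle : ‖Fs' k x‖ ^ 2 ≤ B ^ 2 := by
      have := hk x hx
      nlinarith
    exact mul_le_mul_of_nonneg_left (pow_le_pow_left₀ (sq_nonneg _) hle _) (by positivity)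
  · -- the constant is integrable on `S`
    rw [lintegral_const, Measure.restrict_apply MeasurableSet.univ, univ_inter]
    exact ENNReal.mul_ne_top (ENNReal.mul_ne_top hG ENNReal.ofReal_ne_top) hSfin
  · -- pointwise convergence on `S`
    refine (ae_restrict_iff' hS).2 (Eventually.of_forall fun x hx => ?_)
    exact ENNReal.Tendsto.mul ((hg.tendsto _).comp (hconv x hx)) (Or.inr ENNReal.ofReal_ne_top)
      ((hJc.tendsto _).comp (hconv' x hx)) (Or.inr (ne_top_of_le_ne_top hG (hgG _)))

end Limits

end Literature.Geometry.GeometricMeasureTheory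

end
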